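import Summits.AnomalousDissipation.AnomalousDissipation.Theorems.SawtoothPulseCascadeK1LocalisedCascadeClassStepH
import Summits.AnomalousDissipation.AnomalousDissipation.Theorems.SawtoothPulseCascadeK1LocalisedCascadeClassBlocksV
import Summits.AnomalousDissipation.AnomalousDissipation.Theorems.SawtoothPulseCascadeK1LocalisedCascadeFarTailB

/-!
# K1loc, line `Spectral` / thin start — helper: SPECTRAL CLASSES THROUGH A HALF-STEP, SUMMED OVER FIBRE BLOCKS WITH BLOCKWISE PLATEAUX (V and H)

Helper file of the prover lane on the crux `K1LocalisedCascade` (stmt-AnomalousDissipation-19491), route `SawtoothPulseCascade`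
(S-B/S-C assembly seat; the LEDGER ASSEMBLY, block layer).  `…ClassBlocksV.tsum_class_vstep_blocks_le` sums
`…ClassStepV.sum_window_iterate_vstep_le` over fibre blocks `[Λ_m, Λ_{m+1})` with ONE plateau function `p`; but the cut-off
`Q₂^m` must grow with the block (the pass-through threshold `Q₁^m ≳ Λ_{m+1}·slope` does), so the plateau
`p_m(n) = ⌊v|n|/u⌋ + Q₂^m` of the ratio classes is BLOCK-DEPENDENT.  This file gives the blockwise-plateau versions for both
half-steps (all other data as in `…ClassBlocksV`; the H side uses `…ClassStepH.sum_window_iterate_hstep_le` and the far tail of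
`b_j` along `e₀`, `…FarTailB.tsum_far_halfIterate_fst_le`):
* `sum_block_iterate_vstep_le'` / **`tsum_class_vstep_blocks_le'`** (V: class of `a_{j+1}`, fibres `k₁`, feed = `b_j`-modes):
  `Σ'[q]‖𝓕a_{j+1}‖² ≤ (√(Σ_{m<M} J_m²) + √(Σ'[P]‖𝓕b_j‖²))² + ((1+γ)^{2(j+1)}/Λ_M)²`;
* `sum_block_iterate_hstep_le` / **`tsum_class_hstep_blocks_le`** (H: class of `b_j`, fibres `k₀`, feed = `a_j`-modes):
  `Σ'[q]‖𝓕b_j‖² ≤ (√(Σ_{m<M} J_m²) + √(Σ'[P]‖𝓕a_j‖²))² + ((1+γ)^{2j}/Λ_M)²`;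
with `J_m = ((Q₁^m+Q₂^m)/(Q₂^m−Q₁^m))·(ε₀^m + A_m√(2N_j·4d₀^m))` and ANY feed predicate `P` implied blockwise by the pass-through
condition — the shape `(w + √feed)² + far` that `…LedgerClassChain` consumes.
No definitions; no statement about the crux. [cite: Grafakos2014, Prop. 3.1.2 (5), Prop. 3.2.7 (3), §3.1.3]
[cite: ElgindiLissMattingly2025, §1 (slope ±1 branches)] [problem: turb]
-/

-- `Summit.<Summit>.<Problem>`: single-conjunct summit, the duplicate namespace segment is deliberate.
set_option linter.dupNamespace false

noncomputable section

namespace Summit.AnomalousDissipation.AnomalousDissipation.Theorems.SawtoothPulseCascade.K1Window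

open MeasureTheory Set Filter Topology UnitAddTorus Function Complex Metric
open scoped Real ENNReal
open Literature.Analysis Literature.Analysis.FunctionSpaces Literature.Analysis.FunctionSpaces.Torus Literature.Analysis.FluidPDE
open Literature.Analysis.FluidPDE.ShearStage
open Literature.Analysis.FluidPDE.SawtoothCascade Literature.Analysis.FluidPDE.SawtoothCascade.CascadeParams
open Summit.AnomalousDissipation.AnomalousDissipation.Theorems.SawtoothPulseCascade.K1Start
open Summit.AnomalousDissipation.AnomalousDissipation.Theorems.SawtoothPulseCascade.K1Flat
open Summit.AnomalousDissipation.AnomalousDissipation.Theorems.SawtoothPulseCascade.K1Ledger.From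

section Cascade

variable (P : CascadeParams)

/-! ## §1 V half-step: blocks of fibres `k₁` with blockwise plateaux -/

/-- **One fibre block of a V-window of `a_{j+1}`** (as `…ClassBlocksV.sum_block_iterate_vstep_le`, with the plateau condition asked
on the block only): `…ClassStepV.sum_window_iterate_vstep_le` applied to the block
`W_m = W ∩ {Λ_m ≤ |k₁| < Λ_{m+1}}` with the block's cut-offs `Q₁^m < Q₂^m` and kernel data `(d₀, A, τ, ε₀)_m`; the pass-through
energy is written in the half-open form `Σ'[Λ_m ≤ |k₁| < Λ_{m+1} ∧ Q₁^m < |k₀|]‖𝓕b_j‖²` (so that the blocks add up).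
[cite: Grafakos2014, Prop. 3.1.2 (5), Prop. 3.2.7 (3), §3.1.3] -/
theorem sum_block_iterate_vstep_le' {G : ℕ} (hγ : P.γ = G) (hδ₀ : 0 < P.δ₀) (hd : 0 < P.d) (hN₀ : 1 ≤ P.N₀)
    (hρN : 1 ≤ P.ρN) (a b : ℕ → UnitAddTorus (Fin 2) → ℝ) (has : ∀ j, IsSmooth (a j)) (h0 : a 0 = datum)
    (hb : ∀ j, b j = a j ∘ shearMap 0 1 (amp ⟨P.U j, P.U_periodic j, P.contDiff_U (P.δ_pos hδ₀ hd j)⟩ P.γ))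
    (hab : ∀ j, a (j + 1) = b j ∘ shearMap 1 0 (amp ⟨P.U j, P.U_periodic j, P.contDiff_U (P.δ_pos hδ₀ hd j)⟩ P.γ))
    (j : ℕ) (p : ℤ → ℕ) (W : Finset (Fin 2 → ℤ)) {Λ Λt Q₁ Q₂ : ℕ} (hΛt : 1 ≤ Λt) (hQ : Q₁ < Q₂)
    (hpG : ∀ k ∈ W, (Λ : ℤ) ≤ |k 1| → |k 1| < (Λt : ℤ) → p (k 1) < (k 1).natAbs * G)
    (hWp : ∀ k ∈ W, (Λ : ℤ) ≤ |k 1| → |k 1| < (Λt : ℤ) → |k 0| + Q₂ ≤ (p (k 1) : ℤ))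
    {d₀ M ε₀ A τ : ℝ} (hd₀ : 0 < d₀) (hM : 1 ≤ M) (hMδ : M * P.δ j < π / 2) (hMd : M * P.δ j < π * P.N j * d₀)
    (hA0 : 0 ≤ A)
    (hA : ∀ k ∈ W, (Λ : ℤ) ≤ |k 1| → |k 1| < (Λt : ℤ) →
      ((p (k 1) : ℝ) + ((k 1).natAbs * G : ℕ)) / ((((k 1).natAbs * G : ℕ) : ℝ) - p (k 1)) ≤ A)
    (hτ : ∀ k ∈ W, (Λ : ℤ) ≤ |k 1| → |k 1| < (Λt : ℤ) → π / ((((k 1).natAbs * G : ℕ) : ℝ) - p (k 1)) ≤ τ)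
    (hAd : 8 * τ ≤ A * d₀) (hε0 : 0 ≤ ε₀)
    (hε : A * (2 * π * ((Λt * G : ℕ) : ℝ) * (Real.exp (-(M ^ 2 / 2)) / (2 * P.N j))) ≤ ε₀) :
    ∑ k ∈ W.filter (fun k => (Λ : ℤ) ≤ |k 1| ∧ |k 1| < (Λt : ℤ)), ‖mFourierCoeff (fun x => (a (j + 1) x : ℂ)) k‖ ^ 2 ≤
      ((((Q₁ : ℝ) + Q₂) / ((Q₂ : ℝ) - Q₁)) * (ε₀ + A * Real.sqrt ((2 * P.N j : ℕ) * (4 * d₀))) +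
        Real.sqrt (∑' k : Fin 2 → ℤ, (if (Λ : ℤ) ≤ |k 1| ∧ |k 1| < (Λt : ℤ) ∧ (Q₁ : ℤ) < |k 0| then (1 : ℝ) else 0) *
          ‖mFourierCoeff (fun x => (b j x : ℂ)) k‖ ^ 2)) ^ 2 := by
  classical
  set Wm : Finset (Fin 2 → ℤ) := W.filter (fun k => (Λ : ℤ) ≤ |k 1| ∧ |k 1| < (Λt : ℤ)) with hWm
  have hmem : ∀ k ∈ Wm, k ∈ W ∧ (Λ : ℤ) ≤ |k 1| ∧ |k 1| < (Λt : ℤ) := fun k hk => by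
    simpa [hWm, Finset.mem_filter] using hk
  -- the block top as a natural number `Λt - 1`
  have hcast : (((Λt - 1 : ℕ) : ℤ)) = (Λt : ℤ) - 1 := by push_cast [Nat.cast_sub hΛt]; ring
  have hW' : ∀ k ∈ Wm, (Λ : ℤ) ≤ |k 1| ∧ |k 1| ≤ ((Λt - 1 : ℕ) : ℤ) := fun k hk => by
    obtain ⟨-, h1, h2⟩ := hmem k hk
    exact ⟨h1, by rw [hcast]; exact Int.le_sub_one_iff.mpr h2⟩
  have hWp' : ∀ k ∈ Wm, |k 0| + Q₂ ≤ (p (k 1) : ℤ) := fun k hk => by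
    obtain ⟨hkW, h1, h2⟩ := hmem k hk; exact hWp k hkW h1 h2
  have hpG' : ∀ k ∈ Wm, p (k 1) < (k 1).natAbs * G := fun k hk => by
    obtain ⟨hkW, h1, h2⟩ := hmem k hk; exact hpG k hkW h1 h2
  have hA' : ∀ k ∈ Wm, ((p (k 1) : ℝ) + ((k 1).natAbs * G : ℕ)) / ((((k 1).natAbs * G : ℕ) : ℝ) - p (k 1)) ≤ A :=
    fun k hk => by obtain ⟨hkW, h1, h2⟩ := hmem k hk; exact hA k hkW h1 h2
  have hτ' : ∀ k ∈ Wm, π / ((((k 1).natAbs * G : ℕ) : ℝ) - p (k 1)) ≤ τ :=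
    fun k hk => by obtain ⟨hkW, h1, h2⟩ := hmem k hk; exact hτ k hkW h1 h2
  -- the rounding remainder bound at the block top `Λt - 1 ≤ Λt`
  have hε' : A * (2 * π * (((Λt - 1) * G : ℕ) : ℝ) * (Real.exp (-(M ^ 2 / 2)) / (2 * P.N j))) ≤ ε₀ := by
    refine le_trans ?_ hε
    have hN : (0 : ℝ) < P.N j := by exact_mod_cast P.N_pos hN₀ hρN j
    have hle : (((Λt - 1) * G : ℕ) : ℝ) ≤ ((Λt * G : ℕ) : ℝ) := by
      exact_mod_cast Nat.mul_le_mul_right G (Nat.sub_le Λt 1)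
    have h2 : 0 ≤ Real.exp (-(M ^ 2 / 2)) / (2 * P.N j) := by positivity
    refine mul_le_mul_of_nonneg_left ?_ hA0
    exact mul_le_mul_of_nonneg_right (mul_le_mul_of_nonneg_left hle (by positivity)) h2
  have h := sum_window_iterate_vstep_le P hγ hδ₀ hd hN₀ hρN a b has h0 hb hab j hQ p Wm hW' hWp' hpG' hd₀ hM hMδ hMd hA0
    hA' hτ' hAd hε0 hε'
  refine h.trans (le_of_eq ?_)
  congr 3
  refine tsum_congr fun k => ?_
  congr 1
  refine if_congr ?_ rfl rfl
  rw [hcast, Int.le_sub_one_iff]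


/-- **A V-CLASS OF `a_{j+1}` SUMMED OVER FIBRE BLOCKS, blockwise plateaux `p_m`** (see the file header): blocks `[Λ_m, Λ_{m+1})`, `m < M`, of fibres
`k₁` (`Λ` monotone, `Λ₀ ≥ 1`), a finite window `W ⊇ {q} ∩ {|k₁| < Λ_M}` inside `{Λ₀ ≤ |k₁| < Λ_M}` with plateau `p(k₁) < |k₁|G`
and, on block `m`, `|k₀| + Q₂^m ≤ p(k₁)`; block data `Q₁^m < Q₂^m`, `d₀^m, A_m, τ_m, ε₀^m` with the hypotheses of
`…WindowBlockV` blockwise; a feed predicate `P` implied on every block by the pass-through condition `Q₁^m < |k₀|`.  Then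
`Σ'[q]‖𝓕a_{j+1}‖² ≤ (√(Σ_{m<M} J_m²) + √(Σ'[P]‖𝓕b_j‖²))² + ((1+γ)^{2(j+1)}/Λ_M)²`.
[cite: Grafakos2014, Prop. 3.1.2 (5), Prop. 3.2.7 (3), §3.1.3] -/
theorem tsum_class_vstep_blocks_le' {G : ℕ} (hγ : P.γ = G) (hδ₀ : 0 < P.δ₀) (hd : 0 < P.d) (hN₀ : 1 ≤ P.N₀)
    (hρN : 1 ≤ P.ρN) (a b : ℕ → UnitAddTorus (Fin 2) → ℝ) (has : ∀ j, IsSmooth (a j)) (h0 : a 0 = datum)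
    (hb : ∀ j, b j = a j ∘ shearMap 0 1 (amp ⟨P.U j, P.U_periodic j, P.contDiff_U (P.δ_pos hδ₀ hd j)⟩ P.γ))
    (hab : ∀ j, a (j + 1) = b j ∘ shearMap 1 0 (amp ⟨P.U j, P.U_periodic j, P.contDiff_U (P.δ_pos hδ₀ hd j)⟩ P.γ))
    (j : ℕ) (p : ℕ → ℤ → ℕ) (q : (Fin 2 → ℤ) → Prop) [DecidablePred q]
    (Λb : ℕ → ℕ) (hΛb : Monotone Λb) (hΛ0 : 1 ≤ Λb 0) (Mb : ℕ)
    (W : Finset (Fin 2 → ℤ)) (hqW : ∀ k, q k → |k 1| < (Λb Mb : ℤ) → k ∈ W)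
    (hW : ∀ k ∈ W, (Λb 0 : ℤ) ≤ |k 1| ∧ |k 1| < (Λb Mb : ℤ))
    (hpG : ∀ m, ∀ k ∈ W, (Λb m : ℤ) ≤ |k 1| → |k 1| < (Λb (m + 1) : ℤ) → p m (k 1) < (k 1).natAbs * G)
    (Q₁ Q₂ : ℕ → ℕ) (hQ : ∀ m, Q₁ m < Q₂ m)
    (hWp : ∀ m, ∀ k ∈ W, (Λb m : ℤ) ≤ |k 1| → |k 1| < (Λb (m + 1) : ℤ) → |k 0| + Q₂ m ≤ (p m (k 1) : ℤ))
    {M : ℝ} (hM : 1 ≤ M) (hMδ : M * P.δ j < π / 2)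
    (d₀ A τ ε₀ : ℕ → ℝ) (hd₀ : ∀ m, 0 < d₀ m) (hMd : ∀ m, M * P.δ j < π * P.N j * d₀ m) (hA0 : ∀ m, 0 ≤ A m)
    (hA : ∀ m, ∀ k ∈ W, (Λb m : ℤ) ≤ |k 1| → |k 1| < (Λb (m + 1) : ℤ) →
      ((p m (k 1) : ℝ) + ((k 1).natAbs * G : ℕ)) / ((((k 1).natAbs * G : ℕ) : ℝ) - p m (k 1)) ≤ A m)
    (hτ : ∀ m, ∀ k ∈ W, (Λb m : ℤ) ≤ |k 1| → |k 1| < (Λb (m + 1) : ℤ) →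
      π / ((((k 1).natAbs * G : ℕ) : ℝ) - p m (k 1)) ≤ τ m)
    (hAd : ∀ m, 8 * τ m ≤ A m * d₀ m) (hε0 : ∀ m, 0 ≤ ε₀ m)
    (hε : ∀ m, A m * (2 * π * ((Λb (m + 1) * G : ℕ) : ℝ) * (Real.exp (-(M ^ 2 / 2)) / (2 * P.N j))) ≤ ε₀ m)
    (Pf : (Fin 2 → ℤ) → Prop) [DecidablePred Pf]
    (hPf : ∀ m, ∀ k : Fin 2 → ℤ, (Λb m : ℤ) ≤ |k 1| → |k 1| < (Λb (m + 1) : ℤ) → (Q₁ m : ℤ) < |k 0| → Pf k) :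
    ∑' k : Fin 2 → ℤ, (if q k then (1 : ℝ) else 0) * ‖mFourierCoeff (fun x => (a (j + 1) x : ℂ)) k‖ ^ 2 ≤
      (Real.sqrt (∑ m ∈ Finset.range Mb, ((((Q₁ m : ℝ) + Q₂ m) / ((Q₂ m : ℝ) - Q₁ m)) *
            (ε₀ m + A m * Real.sqrt ((2 * P.N j : ℕ) * (4 * d₀ m)))) ^ 2) +
          Real.sqrt (∑' k : Fin 2 → ℤ, (if Pf k then (1 : ℝ) else 0) * ‖mFourierCoeff (fun x => (b j x : ℂ)) k‖ ^ 2)) ^ 2 +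
        ((1 + P.γ) ^ (2 * (j + 1)) / Λb Mb) ^ 2 := by
  classical
  have hγ0 : 0 ≤ P.γ := by rw [hγ]; exact Nat.cast_nonneg G
  have hbs : IsSmooth (b j) := isSmooth_b P hδ₀ hd a b has hb j
  have hac : Continuous fun x => (a (j + 1) x : ℂ) := by
    rw [hab j]; exact Complex.continuous_ofReal.comp (hbs.continuous.comp (continuous_shearMap 1 0 _))
  set ca : (Fin 2 → ℤ) → ℝ := fun k => ‖mFourierCoeff (fun x => (a (j + 1) x : ℂ)) k‖ ^ 2 with hca
  set cb : (Fin 2 → ℤ) → ℝ := fun k => ‖mFourierCoeff (fun x => (b j x : ℂ)) k‖ ^ 2 with hcb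
  have hcas : Summable ca := (hasSum_sq_mFourierCoeff_of_continuous hac).summable
  have hcbs : Summable cb :=
    (hasSum_sq_mFourierCoeff_of_continuous (Complex.continuous_ofReal.comp hbs.continuous)).summable
  have hca0 : ∀ k, 0 ≤ ca k := fun k => sq_nonneg _
  have hcb0 : ∀ k, 0 ≤ cb k := fun k => sq_nonneg _
  have hIb : ∀ (r : (Fin 2 → ℤ) → Prop) [DecidablePred r], Summable fun k => (if r k then (1 : ℝ) else 0) * cb k := by
    intro r _
    refine Summable.of_nonneg_of_le (fun k => mul_nonneg (by split_ifs <;> norm_num) (hcb0 k)) (fun k => ?_) hcbs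
    exact mul_le_of_le_one_left (hcb0 k) (by split_ifs <;> norm_num)
  -- Step 1: far split at `Λ_M`
  have hMb1 : 1 ≤ Λb Mb := hΛ0.trans (hΛb (Nat.zero_le Mb))
  have hMb0 : (0 : ℝ) < Λb Mb := by exact_mod_cast hMb1
  have h1 := tsum_indicator_le_sum_add_far_of_lt hcas hca0 q 1 (Λb Mb) W hqW
  have hfar := tsum_far_iterate_le P hγ0 hδ₀ hd a b has h0 hb hab (j + 1) 1 (R := (Λb Mb : ℝ)) hMb0
  -- Step 2: the window along the blocks
  have hΛz : Monotone (fun m => (Λb m : ℤ)) := fun m n h => by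
    show (Λb m : ℤ) ≤ (Λb n : ℤ)
    exact_mod_cast hΛb h
  have hWeq : W.filter (fun k => (Λb 0 : ℤ) ≤ |k 1| ∧ |k 1| < (Λb Mb : ℤ)) = W :=
    Finset.filter_true_of_mem fun k hk => hW k hk
  have h2 : ∑ k ∈ W, ca k =
      ∑ m ∈ Finset.range Mb, ∑ k ∈ W.filter (fun k => (Λb m : ℤ) ≤ |k 1| ∧ |k 1| < (Λb (m + 1) : ℤ)), ca k := by
    conv_lhs => rw [← hWeq]
    exact sum_filter_blocks_eq W ca (fun k : Fin 2 → ℤ => |k 1|) hΛz Mb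
  -- Step 3: each block
  set u : ℕ → ℝ := fun m => (((Q₁ m : ℝ) + Q₂ m) / ((Q₂ m : ℝ) - Q₁ m)) *
    (ε₀ m + A m * Real.sqrt ((2 * P.N j : ℕ) * (4 * d₀ m))) with hu
  set y : ℕ → ℝ := fun m => ∑' k : Fin 2 → ℤ,
    (if (Λb m : ℤ) ≤ |k 1| ∧ |k 1| < (Λb (m + 1) : ℤ) ∧ (Q₁ m : ℤ) < |k 0| then (1 : ℝ) else 0) * cb k with hy
  have hu0 : ∀ m, 0 ≤ u m := fun m => by
    have hr : 0 ≤ ((Q₁ m : ℝ) + Q₂ m) / ((Q₂ m : ℝ) - Q₁ m) := by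
      have hQ' : (Q₁ m : ℝ) < Q₂ m := by exact_mod_cast hQ m
      exact div_nonneg (by positivity) (by linarith)
    have h2' : 0 ≤ ε₀ m + A m * Real.sqrt ((2 * P.N j : ℕ) * (4 * d₀ m)) :=
      add_nonneg (hε0 m) (mul_nonneg (hA0 m) (Real.sqrt_nonneg _))
    exact mul_nonneg hr h2'
  have hy0 : ∀ m, 0 ≤ y m := fun m => tsum_nonneg fun k => mul_nonneg (by split_ifs <;> norm_num) (hcb0 k)
  have hblock : ∀ m, ∑ k ∈ W.filter (fun k => (Λb m : ℤ) ≤ |k 1| ∧ |k 1| < (Λb (m + 1) : ℤ)), ca k ≤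
      (u m + Real.sqrt (y m)) ^ 2 := fun m =>
    sum_block_iterate_vstep_le' P hγ hδ₀ hd hN₀ hρN a b has h0 hb hab j (p m) W (hΛ0.trans (hΛb (Nat.zero_le _))) (hQ m)
      (hpG m) (hWp m) (hd₀ m) hM hMδ (hMd m) (hA0 m) (hA m) (hτ m) (hAd m) (hε0 m) (hε m)
  -- Step 4: ℓ²-Minkowski over the blocks
  have h4 : ∑ m ∈ Finset.range Mb, ∑ k ∈ W.filter (fun k => (Λb m : ℤ) ≤ |k 1| ∧ |k 1| < (Λb (m + 1) : ℤ)), ca k ≤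
      (Real.sqrt (∑ m ∈ Finset.range Mb, u m ^ 2) + Real.sqrt (∑ m ∈ Finset.range Mb, y m)) ^ 2 :=
    sum_le_sq_sqrt_add_sqrt (Finset.range Mb) (fun m _ => hu0 m) (fun m _ => hy0 m) (fun m _ => hblock m)
  -- Step 5: the pass-through energies of the blocks add up to at most the feed class
  have h5 : ∑ m ∈ Finset.range Mb, y m ≤ ∑' k : Fin 2 → ℤ, (if Pf k then (1 : ℝ) else 0) * cb k := by
    have hle : ∀ m, y m ≤ ∑' k : Fin 2 → ℤ, (if (Λb m : ℤ) ≤ |k 1| ∧ |k 1| < (Λb (m + 1) : ℤ) ∧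
        ((Λb m : ℤ) ≤ |k 1| ∧ |k 1| < (Λb (m + 1) : ℤ) ∧ (Q₁ m : ℤ) < |k 0|) then (1 : ℝ) else 0) * cb k := fun m =>
      (hIb _).tsum_le_tsum (fun k => indicator_mul_le_of_imp (fun h => ⟨h.1, h.2.1, h⟩) (hcb0 k)) (hIb _)
    have hsum := sum_tsum_blocks_le hcbs hcb0 (fun k : Fin 2 → ℤ => |k 1|) hΛz Pf
      (fun m k => (Λb m : ℤ) ≤ |k 1| ∧ |k 1| < (Λb (m + 1) : ℤ) ∧ (Q₁ m : ℤ) < |k 0|)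
      (fun m k h => hPf m k h.1 h.2.1 h.2.2) Mb
    refine ((Finset.sum_le_sum fun m _ => hle m).trans hsum).trans ?_
    exact (hIb _).tsum_le_tsum (fun k => indicator_mul_le_of_imp (fun h => h.2) (hcb0 k)) (hIb _)
  -- Step 6: assemble
  have h6 : ∑ k ∈ W, ca k ≤ (Real.sqrt (∑ m ∈ Finset.range Mb, u m ^ 2) +
      Real.sqrt (∑' k : Fin 2 → ℤ, (if Pf k then (1 : ℝ) else 0) * cb k)) ^ 2 := by
    rw [h2]
    exact le_add_sq_mono h4 (Real.sqrt_nonneg _) (Real.sqrt_nonneg _) le_rfl (Real.sqrt_le_sqrt h5)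
  exact h1.trans (add_le_add h6 hfar)


/-! ## §2 H half-step: blocks of fibres `k₀` with blockwise plateaux -/

/-- **One fibre block of an H-window of `b_j`**: `…ClassStepH.sum_window_iterate_hstep_le` applied to the block
`W_m = W ∩ {Λ_m ≤ |k₀| < Λ_{m+1}}` with the block's cut-offs `Q₁^m < Q₂^m` and kernel data `(d₀, A, τ, ε₀)_m`; the pass-through
energy is written in the half-open form `Σ'[Λ_m ≤ |k₀| < Λ_{m+1} ∧ Q₁^m < |k₁|]‖𝓕a_j‖²` (so that the blocks add up).
[cite: Grafakos2014, Prop. 3.1.2 (5), Prop. 3.2.7 (3), §3.1.3] -/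
theorem sum_block_iterate_hstep_le {G : ℕ} (hγ : P.γ = G) (hδ₀ : 0 < P.δ₀) (hd : 0 < P.d) (hN₀ : 1 ≤ P.N₀)
    (hρN : 1 ≤ P.ρN) (a b : ℕ → UnitAddTorus (Fin 2) → ℝ) (has : ∀ j, IsSmooth (a j)) (h0 : a 0 = datum)
    (hb : ∀ j, b j = a j ∘ shearMap 0 1 (amp ⟨P.U j, P.U_periodic j, P.contDiff_U (P.δ_pos hδ₀ hd j)⟩ P.γ))
    (hab : ∀ j, a (j + 1) = b j ∘ shearMap 1 0 (amp ⟨P.U j, P.U_periodic j, P.contDiff_U (P.δ_pos hδ₀ hd j)⟩ P.γ))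
    (j : ℕ) (p : ℤ → ℕ) (W : Finset (Fin 2 → ℤ)) {Λ Λt Q₁ Q₂ : ℕ} (hΛt : 1 ≤ Λt) (hQ : Q₁ < Q₂)
    (hpG : ∀ k ∈ W, (Λ : ℤ) ≤ |k 0| → |k 0| < (Λt : ℤ) → p (k 0) < (k 0).natAbs * G)
    (hWp : ∀ k ∈ W, (Λ : ℤ) ≤ |k 0| → |k 0| < (Λt : ℤ) → |k 1| + Q₂ ≤ (p (k 0) : ℤ))
    {d₀ M ε₀ A τ : ℝ} (hd₀ : 0 < d₀) (hM : 1 ≤ M) (hMδ : M * P.δ j < π / 2) (hMd : M * P.δ j < π * P.N j * d₀)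
    (hA0 : 0 ≤ A)
    (hA : ∀ k ∈ W, (Λ : ℤ) ≤ |k 0| → |k 0| < (Λt : ℤ) →
      ((p (k 0) : ℝ) + ((k 0).natAbs * G : ℕ)) / ((((k 0).natAbs * G : ℕ) : ℝ) - p (k 0)) ≤ A)
    (hτ : ∀ k ∈ W, (Λ : ℤ) ≤ |k 0| → |k 0| < (Λt : ℤ) → π / ((((k 0).natAbs * G : ℕ) : ℝ) - p (k 0)) ≤ τ)
    (hAd : 8 * τ ≤ A * d₀) (hε0 : 0 ≤ ε₀)
    (hε : A * (2 * π * ((Λt * G : ℕ) : ℝ) * (Real.exp (-(M ^ 2 / 2)) / (2 * P.N j))) ≤ ε₀) :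
    ∑ k ∈ W.filter (fun k => (Λ : ℤ) ≤ |k 0| ∧ |k 0| < (Λt : ℤ)), ‖mFourierCoeff (fun x => (b j x : ℂ)) k‖ ^ 2 ≤
      ((((Q₁ : ℝ) + Q₂) / ((Q₂ : ℝ) - Q₁)) * (ε₀ + A * Real.sqrt ((2 * P.N j : ℕ) * (4 * d₀))) +
        Real.sqrt (∑' k : Fin 2 → ℤ, (if (Λ : ℤ) ≤ |k 0| ∧ |k 0| < (Λt : ℤ) ∧ (Q₁ : ℤ) < |k 1| then (1 : ℝ) else 0) *
          ‖mFourierCoeff (fun x => (a j x : ℂ)) k‖ ^ 2)) ^ 2 := by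
  classical
  set Wm : Finset (Fin 2 → ℤ) := W.filter (fun k => (Λ : ℤ) ≤ |k 0| ∧ |k 0| < (Λt : ℤ)) with hWm
  have hmem : ∀ k ∈ Wm, k ∈ W ∧ (Λ : ℤ) ≤ |k 0| ∧ |k 0| < (Λt : ℤ) := fun k hk => by
    simpa [hWm, Finset.mem_filter] using hk
  -- the block top as a natural number `Λt - 1`
  have hcast : (((Λt - 1 : ℕ) : ℤ)) = (Λt : ℤ) - 1 := by push_cast [Nat.cast_sub hΛt]; ring
  have hW' : ∀ k ∈ Wm, (Λ : ℤ) ≤ |k 0| ∧ |k 0| ≤ ((Λt - 1 : ℕ) : ℤ) := fun k hk => by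
    obtain ⟨-, h1, h2⟩ := hmem k hk
    exact ⟨h1, by rw [hcast]; exact Int.le_sub_one_iff.mpr h2⟩
  have hWp' : ∀ k ∈ Wm, |k 1| + Q₂ ≤ (p (k 0) : ℤ) := fun k hk => by
    obtain ⟨hkW, h1, h2⟩ := hmem k hk; exact hWp k hkW h1 h2
  have hpG' : ∀ k ∈ Wm, p (k 0) < (k 0).natAbs * G := fun k hk => by
    obtain ⟨hkW, h1, h2⟩ := hmem k hk; exact hpG k hkW h1 h2
  have hA' : ∀ k ∈ Wm, ((p (k 0) : ℝ) + ((k 0).natAbs * G : ℕ)) / ((((k 0).natAbs * G : ℕ) : ℝ) - p (k 0)) ≤ A :=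
    fun k hk => by obtain ⟨hkW, h1, h2⟩ := hmem k hk; exact hA k hkW h1 h2
  have hτ' : ∀ k ∈ Wm, π / ((((k 0).natAbs * G : ℕ) : ℝ) - p (k 0)) ≤ τ :=
    fun k hk => by obtain ⟨hkW, h1, h2⟩ := hmem k hk; exact hτ k hkW h1 h2
  -- the rounding remainder bound at the block top `Λt - 1 ≤ Λt`
  have hε' : A * (2 * π * (((Λt - 1) * G : ℕ) : ℝ) * (Real.exp (-(M ^ 2 / 2)) / (2 * P.N j))) ≤ ε₀ := by
    refine le_trans ?_ hε
    have hN : (0 : ℝ) < P.N j := by exact_mod_cast P.N_pos hN₀ hρN j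
    have hle : (((Λt - 1) * G : ℕ) : ℝ) ≤ ((Λt * G : ℕ) : ℝ) := by
      exact_mod_cast Nat.mul_le_mul_right G (Nat.sub_le Λt 1)
    have h2 : 0 ≤ Real.exp (-(M ^ 2 / 2)) / (2 * P.N j) := by positivity
    refine mul_le_mul_of_nonneg_left ?_ hA0
    exact mul_le_mul_of_nonneg_right (mul_le_mul_of_nonneg_left hle (by positivity)) h2
  have h := sum_window_iterate_hstep_le P hγ hδ₀ hd hN₀ hρN a b has h0 hb hab j hQ p Wm hW' hWp' hpG' hd₀ hM hMδ hMd hA0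
    hA' hτ' hAd hε0 hε'
  refine h.trans (le_of_eq ?_)
  congr 3
  refine tsum_congr fun k => ?_
  congr 1
  refine if_congr ?_ rfl rfl
  rw [hcast, Int.le_sub_one_iff]


/-- **AN H-CLASS OF `b_j` SUMMED OVER FIBRE BLOCKS** (see the file header): blocks `[Λ_m, Λ_{m+1})`, `m < M`, of fibres
`k₀` (`Λ` monotone, `Λ₀ ≥ 1`), a finite window `W ⊇ {q} ∩ {|k₀| < Λ_M}` inside `{Λ₀ ≤ |k₀| < Λ_M}` with plateau `p(k₀) < |k₀|G`
and, on block `m`, `|k₁| + Q₂^m ≤ p(k₀)`; block data `Q₁^m < Q₂^m`, `d₀^m, A_m, τ_m, ε₀^m` with the hypotheses of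
`…WindowBlockH` blockwise; a feed predicate `P` implied on every block by the pass-through condition `Q₁^m < |k₁|`.  Then
`Σ'[q]‖𝓕b_j‖² ≤ (√(Σ_{m<M} J_m²) + √(Σ'[P]‖𝓕a_j‖²))² + ((1+γ)^{2j}/Λ_M)²`.
[cite: Grafakos2014, Prop. 3.1.2 (5), Prop. 3.2.7 (3), §3.1.3] -/
theorem tsum_class_hstep_blocks_le {G : ℕ} (hγ : P.γ = G) (hδ₀ : 0 < P.δ₀) (hd : 0 < P.d) (hN₀ : 1 ≤ P.N₀)
    (hρN : 1 ≤ P.ρN) (a b : ℕ → UnitAddTorus (Fin 2) → ℝ) (has : ∀ j, IsSmooth (a j)) (h0 : a 0 = datum)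
    (hb : ∀ j, b j = a j ∘ shearMap 0 1 (amp ⟨P.U j, P.U_periodic j, P.contDiff_U (P.δ_pos hδ₀ hd j)⟩ P.γ))
    (hab : ∀ j, a (j + 1) = b j ∘ shearMap 1 0 (amp ⟨P.U j, P.U_periodic j, P.contDiff_U (P.δ_pos hδ₀ hd j)⟩ P.γ))
    (j : ℕ) (p : ℕ → ℤ → ℕ) (q : (Fin 2 → ℤ) → Prop) [DecidablePred q]
    (Λb : ℕ → ℕ) (hΛb : Monotone Λb) (hΛ0 : 1 ≤ Λb 0) (Mb : ℕ)
    (W : Finset (Fin 2 → ℤ)) (hqW : ∀ k, q k → |k 0| < (Λb Mb : ℤ) → k ∈ W)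
    (hW : ∀ k ∈ W, (Λb 0 : ℤ) ≤ |k 0| ∧ |k 0| < (Λb Mb : ℤ))
    (hpG : ∀ m, ∀ k ∈ W, (Λb m : ℤ) ≤ |k 0| → |k 0| < (Λb (m + 1) : ℤ) → p m (k 0) < (k 0).natAbs * G)
    (Q₁ Q₂ : ℕ → ℕ) (hQ : ∀ m, Q₁ m < Q₂ m)
    (hWp : ∀ m, ∀ k ∈ W, (Λb m : ℤ) ≤ |k 0| → |k 0| < (Λb (m + 1) : ℤ) → |k 1| + Q₂ m ≤ (p m (k 0) : ℤ))
    {M : ℝ} (hM : 1 ≤ M) (hMδ : M * P.δ j < π / 2)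
    (d₀ A τ ε₀ : ℕ → ℝ) (hd₀ : ∀ m, 0 < d₀ m) (hMd : ∀ m, M * P.δ j < π * P.N j * d₀ m) (hA0 : ∀ m, 0 ≤ A m)
    (hA : ∀ m, ∀ k ∈ W, (Λb m : ℤ) ≤ |k 0| → |k 0| < (Λb (m + 1) : ℤ) →
      ((p m (k 0) : ℝ) + ((k 0).natAbs * G : ℕ)) / ((((k 0).natAbs * G : ℕ) : ℝ) - p m (k 0)) ≤ A m)
    (hτ : ∀ m, ∀ k ∈ W, (Λb m : ℤ) ≤ |k 0| → |k 0| < (Λb (m + 1) : ℤ) →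
      π / ((((k 0).natAbs * G : ℕ) : ℝ) - p m (k 0)) ≤ τ m)
    (hAd : ∀ m, 8 * τ m ≤ A m * d₀ m) (hε0 : ∀ m, 0 ≤ ε₀ m)
    (hε : ∀ m, A m * (2 * π * ((Λb (m + 1) * G : ℕ) : ℝ) * (Real.exp (-(M ^ 2 / 2)) / (2 * P.N j))) ≤ ε₀ m)
    (Pf : (Fin 2 → ℤ) → Prop) [DecidablePred Pf]
    (hPf : ∀ m, ∀ k : Fin 2 → ℤ, (Λb m : ℤ) ≤ |k 0| → |k 0| < (Λb (m + 1) : ℤ) → (Q₁ m : ℤ) < |k 1| → Pf k) :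
    ∑' k : Fin 2 → ℤ, (if q k then (1 : ℝ) else 0) * ‖mFourierCoeff (fun x => (b j x : ℂ)) k‖ ^ 2 ≤
      (Real.sqrt (∑ m ∈ Finset.range Mb, ((((Q₁ m : ℝ) + Q₂ m) / ((Q₂ m : ℝ) - Q₁ m)) *
            (ε₀ m + A m * Real.sqrt ((2 * P.N j : ℕ) * (4 * d₀ m)))) ^ 2) +
          Real.sqrt (∑' k : Fin 2 → ℤ, (if Pf k then (1 : ℝ) else 0) * ‖mFourierCoeff (fun x => (a j x : ℂ)) k‖ ^ 2)) ^ 2 +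
        ((1 + P.γ) ^ (2 * j) / Λb Mb) ^ 2 := by
  classical
  have hγ0 : 0 ≤ P.γ := by rw [hγ]; exact Nat.cast_nonneg G
  have hbs : IsSmooth (b j) := isSmooth_b P hδ₀ hd a b has hb j
  have hbc : Continuous fun x => (b j x : ℂ) := Complex.continuous_ofReal.comp hbs.continuous
  set ca : (Fin 2 → ℤ) → ℝ := fun k => ‖mFourierCoeff (fun x => (b j x : ℂ)) k‖ ^ 2 with hca
  set cb : (Fin 2 → ℤ) → ℝ := fun k => ‖mFourierCoeff (fun x => (a j x : ℂ)) k‖ ^ 2 with hcb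
  have hcas : Summable ca := (hasSum_sq_mFourierCoeff_of_continuous hbc).summable
  have hcbs : Summable cb :=
    (hasSum_sq_mFourierCoeff_of_continuous (Complex.continuous_ofReal.comp (has j).continuous)).summable
  have hca0 : ∀ k, 0 ≤ ca k := fun k => sq_nonneg _
  have hcb0 : ∀ k, 0 ≤ cb k := fun k => sq_nonneg _
  have hIb : ∀ (r : (Fin 2 → ℤ) → Prop) [DecidablePred r], Summable fun k => (if r k then (1 : ℝ) else 0) * cb k := by
    intro r _
    refine Summable.of_nonneg_of_le (fun k => mul_nonneg (by split_ifs <;> norm_num) (hcb0 k)) (fun k => ?_) hcbs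
    exact mul_le_of_le_one_left (hcb0 k) (by split_ifs <;> norm_num)
  -- Step 1: far split at `Λ_M`
  have hMb1 : 1 ≤ Λb Mb := hΛ0.trans (hΛb (Nat.zero_le Mb))
  have hMb0 : (0 : ℝ) < Λb Mb := by exact_mod_cast hMb1
  have h1 := tsum_indicator_le_sum_add_far_of_lt hcas hca0 q 0 (Λb Mb) W hqW
  have hfar := tsum_far_halfIterate_fst_le P hγ0 hδ₀ hd a b has h0 hb hab j (R := (Λb Mb : ℝ)) hMb0
  -- Step 2: the window along the blocks
  have hΛz : Monotone (fun m => (Λb m : ℤ)) := fun m n h => by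
    show (Λb m : ℤ) ≤ (Λb n : ℤ)
    exact_mod_cast hΛb h
  have hWeq : W.filter (fun k => (Λb 0 : ℤ) ≤ |k 0| ∧ |k 0| < (Λb Mb : ℤ)) = W :=
    Finset.filter_true_of_mem fun k hk => hW k hk
  have h2 : ∑ k ∈ W, ca k =
      ∑ m ∈ Finset.range Mb, ∑ k ∈ W.filter (fun k => (Λb m : ℤ) ≤ |k 0| ∧ |k 0| < (Λb (m + 1) : ℤ)), ca k := by
    conv_lhs => rw [← hWeq]
    exact sum_filter_blocks_eq W ca (fun k : Fin 2 → ℤ => |k 0|) hΛz Mb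
  -- Step 3: each block
  set u : ℕ → ℝ := fun m => (((Q₁ m : ℝ) + Q₂ m) / ((Q₂ m : ℝ) - Q₁ m)) *
    (ε₀ m + A m * Real.sqrt ((2 * P.N j : ℕ) * (4 * d₀ m))) with hu
  set y : ℕ → ℝ := fun m => ∑' k : Fin 2 → ℤ,
    (if (Λb m : ℤ) ≤ |k 0| ∧ |k 0| < (Λb (m + 1) : ℤ) ∧ (Q₁ m : ℤ) < |k 1| then (1 : ℝ) else 0) * cb k with hy
  have hu0 : ∀ m, 0 ≤ u m := fun m => by
    have hr : 0 ≤ ((Q₁ m : ℝ) + Q₂ m) / ((Q₂ m : ℝ) - Q₁ m) := by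
      have hQ' : (Q₁ m : ℝ) < Q₂ m := by exact_mod_cast hQ m
      exact div_nonneg (by positivity) (by linarith)
    have h2' : 0 ≤ ε₀ m + A m * Real.sqrt ((2 * P.N j : ℕ) * (4 * d₀ m)) :=
      add_nonneg (hε0 m) (mul_nonneg (hA0 m) (Real.sqrt_nonneg _))
    exact mul_nonneg hr h2'
  have hy0 : ∀ m, 0 ≤ y m := fun m => tsum_nonneg fun k => mul_nonneg (by split_ifs <;> norm_num) (hcb0 k)
  have hblock : ∀ m, ∑ k ∈ W.filter (fun k => (Λb m : ℤ) ≤ |k 0| ∧ |k 0| < (Λb (m + 1) : ℤ)), ca k ≤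
      (u m + Real.sqrt (y m)) ^ 2 := fun m =>
    sum_block_iterate_hstep_le P hγ hδ₀ hd hN₀ hρN a b has h0 hb hab j (p m) W (hΛ0.trans (hΛb (Nat.zero_le _))) (hQ m)
      (hpG m) (hWp m) (hd₀ m) hM hMδ (hMd m) (hA0 m) (hA m) (hτ m) (hAd m) (hε0 m) (hε m)
  -- Step 4: ℓ²-Minkowski over the blocks
  have h4 : ∑ m ∈ Finset.range Mb, ∑ k ∈ W.filter (fun k => (Λb m : ℤ) ≤ |k 0| ∧ |k 0| < (Λb (m + 1) : ℤ)), ca k ≤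
      (Real.sqrt (∑ m ∈ Finset.range Mb, u m ^ 2) + Real.sqrt (∑ m ∈ Finset.range Mb, y m)) ^ 2 :=
    sum_le_sq_sqrt_add_sqrt (Finset.range Mb) (fun m _ => hu0 m) (fun m _ => hy0 m) (fun m _ => hblock m)
  -- Step 5: the pass-through energies of the blocks add up to at most the feed class
  have h5 : ∑ m ∈ Finset.range Mb, y m ≤ ∑' k : Fin 2 → ℤ, (if Pf k then (1 : ℝ) else 0) * cb k := by
    have hle : ∀ m, y m ≤ ∑' k : Fin 2 → ℤ, (if (Λb m : ℤ) ≤ |k 0| ∧ |k 0| < (Λb (m + 1) : ℤ) ∧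
        ((Λb m : ℤ) ≤ |k 0| ∧ |k 0| < (Λb (m + 1) : ℤ) ∧ (Q₁ m : ℤ) < |k 1|) then (1 : ℝ) else 0) * cb k := fun m =>
      (hIb _).tsum_le_tsum (fun k => indicator_mul_le_of_imp (fun h => ⟨h.1, h.2.1, h⟩) (hcb0 k)) (hIb _)
    have hsum := sum_tsum_blocks_le hcbs hcb0 (fun k : Fin 2 → ℤ => |k 0|) hΛz Pf
      (fun m k => (Λb m : ℤ) ≤ |k 0| ∧ |k 0| < (Λb (m + 1) : ℤ) ∧ (Q₁ m : ℤ) < |k 1|)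
      (fun m k h => hPf m k h.1 h.2.1 h.2.2) Mb
    refine ((Finset.sum_le_sum fun m _ => hle m).trans hsum).trans ?_
    exact (hIb _).tsum_le_tsum (fun k => indicator_mul_le_of_imp (fun h => h.2) (hcb0 k)) (hIb _)
  -- Step 6: assemble
  have h6 : ∑ k ∈ W, ca k ≤ (Real.sqrt (∑ m ∈ Finset.range Mb, u m ^ 2) +
      Real.sqrt (∑' k : Fin 2 → ℤ, (if Pf k then (1 : ℝ) else 0) * cb k)) ^ 2 := by
    rw [h2]
    exact le_add_sq_mono h4 (Real.sqrt_nonneg _) (Real.sqrt_nonneg _) le_rfl (Real.sqrt_le_sqrt h5)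
  exact h1.trans (add_le_add h6 hfar)

end Cascade

end Summit.AnomalousDissipation.AnomalousDissipation.Theorems.SawtoothPulseCascade.K1Window
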